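import Literature.AlgebraicGeometry.Frobenioids.Birationalization
import Literature.AlgebraicGeometry.Frobenioids.TwoLevelFrobenioidIsFrobenioid
import HarnessLib

/-!
# Frobenioids I, Proposition 4.4 (i): the colimit relation `BiratFrac.Rel f g` on birational fractions
# (FACT-LIST F-0950) has a REFUTABLE universal closure

Mochizuki, *The geometry of Frobenioids I: the general theory*, Kyushu J. Math. **62** (2008)
293–400, §4, Proposition 4.4 (i)/(ii), kurims text pp. 82–83 [cite: MochizukiFrdI2008, Prop. 4.4(i)
p.83]: "`Hom^birat_C(A, B) := lim_{(A′ → A) ∈ C^coa-pre_A} Hom_C(A′, B)` … (ii) the functor `C → C^birat`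
is faithful" (proof, p. 84: "since [a co-angular pre-step] is a monomorphism …"; `C` is totally
epimorphic, Def. 1.1 (iv) / §0 p. 15).

Negative knowledge recorded next to `Birationalization.lean` (abc-iut-L1; FACT-LIST row **F-0950**
`PreFrobenioid.BiratFrac.Rel`, class `preparatory`, kernel_closedness `parametrised`, status
`conditional(I: BiratFrac.rel_restrict)`), PROOF-ONLY (no definitions, no instances, no notation),
abc-iut cell seat abc-iut-f-025.

The row is a DEFINITION — the relation "`(α, φ′)` and `(β, ψ′)` become equal in the inductive limit
`Hom^birat_C(A, B)`", i.e. they agree after refining by co-angular pre-steps — not a claim; print asserts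
it of no particular pair of fractions.  Its universal closure ("any two birational fractions are
related", i.e. every `Hom^birat_C(A, B)` has at most one element) is false.  This file supplies:

* `BiratFrac.rel_ofHom_iff` — for a Frobenioid, the images `(id, φ)`, `(id, ψ)` of two morphisms
  `φ, ψ : A → B` of `C` are related iff `φ = ψ` (the content of Prop. 4.4 (ii) "`C → C^birat` is
  faithful", at the level of fractions: a relating co-angular pre-step `ε` gives `ε ≫ φ = ε ≫ ψ`, and `ε`
  is an epimorphism since `C` is totally epimorphic); the positive direction is `Rel.refl`;
* `TwoLevel.not_rel_ofHom_topAut` — in the kernel-checked two-level Frobenioid over `B(ℤ/2)`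
  (`TwoLevel.isFrobenioid`, seat abc-iut-L5/L1 test object) the endomorphisms `id` and `(σ, 0, 1)` of
  `top` differ (their base components are `1 ≠ σ`), so their images are NOT related;
* `BiratFrac.not_forall_rel` — hence the fully quantified closure is refuted (F-0950).

The forms the tree consumes are the instance-level theorems of `Birationalization.lean` BY NAME
(`Rel.refl/symm/trans`, `rel_restrict`, `compWith_rel`, `comp_rel_left/right`, `id_comp_rel`,
`comp_id_rel`, `comp_assoc_rel`) and `Birat.homMk_eq_homMk_iff` / `toBirat_faithful`
(`BirationalizationCategory.lean`).  So the row is admissible ONLY as vocabulary (FACT-LIST class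
«universal-closure REFUTED; instance forms in tree»).  Nothing here bears on the disputed [IUTchIII]
Cor. 3.12 or takes a side; refuted is never a fact.
-/

namespace Literature.AlgebraicGeometry.Frobenioids

open CategoryTheory Opposite

universe w v v' u u'

namespace PreFrobenioid.BiratFrac

variable {D : Type u} [Category.{v} D] {Φ : Dᵒᵖ ⥤ CommMonCat.{w}}
  {C : Type u'} [Category.{v'} C] {F : C ⥤ ElemFrobenioid Φ} {A B : C}

/-- **Prop. 4.4 (ii) at the level of fractions**: in a Frobenioid the images `(id, φ)`, `(id, ψ)` of two
morphisms `φ, ψ : A → B` are related in `Hom^birat_C(A, B)` iff `φ = ψ` — a relating pair of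
co-angular pre-steps `ε, ε′` has `ε = ε ≫ id = ε′ ≫ id = ε′` and `ε ≫ φ = ε ≫ ψ`, and `ε` is an
epimorphism (`C` totally epimorphic). [cite: MochizukiFrdI2008, Prop. 4.4(ii) p.83] -/
theorem rel_ofHom_iff (hF : IsFrobenioid F) {φ ψ : A ⟶ B} :
    Rel (ofHom hF φ) (ofHom hF ψ) ↔ φ = ψ := by
  refine ⟨fun h => ?_, fun h => h ▸ Rel.refl hF _⟩
  obtain ⟨E, ε, ε', hε, -, h₁, h₂⟩ := h
  have h₁' : (ε : E ⟶ A) = ε' := by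
    have h' := h₁
    simp only [ofHom, Category.comp_id] at h'
    exact h'
  subst h₁'
  have h₂' : ε ≫ φ = ε ≫ ψ := h₂
  haveI : Epi ε := hF.isPreFrobenioid.isTotallyEpimorphic.epi ε
  exact (cancel_epi ε).mp h₂'

/-- Distinct parallel morphisms of a Frobenioid have non-related images among the birational
fractions. [cite: MochizukiFrdI2008, Prop. 4.4(ii) p.83] -/
theorem not_rel_ofHom (hF : IsFrobenioid F) {φ ψ : A ⟶ B} (h : φ ≠ ψ) :
    ¬ Rel (ofHom hF φ) (ofHom hF ψ) :=
  fun h' => h ((rel_ofHom_iff hF).mp h')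

end PreFrobenioid.BiratFrac

/-! ### The witness: the two-level Frobenioid over `B(ℤ/2)` -/

namespace TwoLevel

open PreFrobenioid

/-- The endomorphism `(σ, 0, 1)` of `top` is not the identity (base components `σ ≠ 1`).
[cite: MochizukiFrdI2008, Prop. 1.6 p.28] -/
theorem toTop_σ_ne_id : toTop Obj.top σ 1 1 ≠ 𝟙 Obj.top := fun h =>
  σ_ne_one (by simpa using congrArg (fun f : Obj.top ⟶ Obj.top => bs f.1) h)

/-- **F-0950, a pair of non-related fractions:** in the two-level Frobenioid the images `(id, id)` and
`(id, (σ, 0, 1))` in `Hom^birat(top, top)` are not related. [cite: MochizukiFrdI2008, Prop. 4.4(i) p.83] -/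
theorem not_rel_ofHom_topAut :
    ¬ BiratFrac.Rel (BiratFrac.ofHom isFrobenioid (toTop Obj.top σ 1 1))
        (BiratFrac.ofHom isFrobenioid (𝟙 Obj.top)) :=
  BiratFrac.not_rel_ofHom isFrobenioid toTop_σ_ne_id

/-- Hence `Hom^birat(top, top)` of the two-level Frobenioid has two non-related fractions.
[cite: MochizukiFrdI2008, Prop. 4.4(i) p.83] -/
theorem exists_not_rel :
    ∃ f g : BiratFrac toElem Obj.top Obj.top, ¬ BiratFrac.Rel f g :=
  ⟨_, _, not_rel_ofHom_topAut⟩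

end TwoLevel

/-! ### The fully quantified closure, refuted at the two-level Frobenioid -/

/-- **FACT-LIST F-0950, universal closure REFUTED** (witness: the two-level Frobenioid over `B(ℤ/2)`,
`A = B = top`, the fractions `(id, (σ, 0, 1))` and `(id, id)`).  The consumed forms (`Rel.refl/symm/trans`,
`rel_restrict`, `comp_rel_left/right`, `Birat.homMk_eq_homMk_iff`, `toBirat_faithful`) are theorems of
the tree. [cite: MochizukiFrdI2008, Prop. 4.4(i) p.83] -/
theorem PreFrobenioid.BiratFrac.not_forall_rel :
    ¬ ∀ (D : Type) [Category.{0} D] (Φ : Dᵒᵖ ⥤ CommMonCat.{0}) (C : Type) [Category.{0} C]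
        (F : C ⥤ ElemFrobenioid Φ) (A B : C)
        (f g : Literature.AlgebraicGeometry.Frobenioids.PreFrobenioid.BiratFrac F A B),
        Literature.AlgebraicGeometry.Frobenioids.PreFrobenioid.BiratFrac.Rel f g :=
  fun h => TwoLevel.not_rel_ofHom_topAut (h _ _ _ TwoLevel.toElem _ _ _ _)

end Literature.AlgebraicGeometry.Frobenioids
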